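/-
Copyright (c) 2026 the pub-hodgecm-mathlib formalisation cell (harness21).  Prover seat hodgecm-mathlib-K2Liu-p12 (g4): Track B «K2-LIT»,
#184♮ = hLiu418 = stmt-HodgeConjecture-24832; Road Φ of socket #41, Φ9 consumer sheet row G2 «G2-rest» (LEAD F0P6-plan (g14) BATCH #28 (1)
2026-09-04T14:09:56Z; K2E5-plan (g7) BATCH #27 (3) (G2-alt)); census `K2/K2Liu-p12/g4/CENSUS-G2rest-GoodPlaceNonUnimodular.K2Liu-p12-g4.md`.  File R2 (global).
-/
import Summits.HodgeConjecture.HodgeConjecture.Theorems.K2LiuGoodPlaceWhittakerEulerAssembly   -- ★ (b): row G2's face currency `(b^U(s))⁻¹ · ∏_{v∈D∖T} W v ∕ m v` (+ ★ O41.6)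
import Summits.HodgeConjecture.HodgeConjecture.Theorems.K2E1WhittakerDenBoundsUniformU3        -- Track-A ★: `norm_one_sub_mul_residueCard_cpow_neg_le_exp`; brings ★ `K2E1WhittakerBoundsUniformU2` (`norm_inv_partialZeta_le_uniform`, `prod_residueCard_pow_le_mul_abs_norm`, `abs_norm_le_norm_mixedEmbedding_pow`)
import Summits.HodgeConjecture.HodgeConjecture.Theorems.K2LiuGKRankOneIdentityLFactor         -- ★ ref1 (C4): `prod_norm_toPlace_uniformizer` (`∏_{w∣v} ‖ι_w π‖_w = q_v⁻²`)
import Literature.NumberTheory.Automorphic.AdicCompletionResidueCard                           -- ★ `residueFieldCard_adicCompletion_eq` (`residueFieldCard F_v = q_v`)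
import HarnessLib

/-!
# Crux `HLiu418`, Road Φ of socket #41, Φ9 sheet row G2 «G2-rest» — THE PRODUCT OVER THE NON-UNIMODULAR GOOD PLACES:
# ONE BOUND FOR `(b^U(s))⁻¹` UNIFORM IN THE MOVING SET `U = D(β) ∪ T`, AND `∏_{v∈D(β)∖T} q_v^{a + b·ord_v(det β)} ≤ (C_T·|N det β|)^{a+b}` BY THE PRODUCT FORMULA

Cell `hodgecm-mathlib`, crux item hLiu418 = `stmt-HodgeConjecture-24832`, route of record `HCCMUnconditional`; squad K2 ∕ K2Liu, road `K2_Liu`,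
socket #41 `sig_K2LiuSiegelEisensteinContinuation`, Road Φ; consumer = the Φ9 sheet row G2 through ★ (b) `K2LiuGoodPlaceWhittakerEulerAssembly`
(face `∏'_{v∉T} W°_{β,v}(1,s)∕μ_v(B_v(0)) = (b^{D(β)∪T}(s))⁻¹ · ∏_{v∈D(β)∖T} W_v(s)∕m_v`) and file R1 ★∕📤 `K2LiuGoodPlaceWhittakerNonUnimodular` (at `v ∈ D(β)∖T`:
`‖W_v(s)‖ ≤ N_v^{3+2·ord_v(det β)}·m_v`, `N_v = q_v^{2n²}`).  THEOREMS ONLY (no `def`, no `instance`, no `notation`, no named-fact hypothesis, no `sorry`);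
lane `--supports stmt-HodgeConjecture-24832` (count-neutral helper; closes no socket by itself).

THE MATHEMATICS — the Φ9 majorant needs the face value bounded on `{σ₀ ≤ Re s}` by a polynomial in the height of `β`, UNIFORMLY in the `β`-dependent
finite set `D(β)` of non-unimodular good places:
* §1 **`norm_inv_b_le_uniform`** (one-place step = Track-A ★ `K2E1WhittakerDenBoundsUniformU3.norm_one_sub_mul_residueCard_cpow_neg_le_exp`) — for a unitary Hecke character `ε` of `F` and `σ₀ > 0` there is ONE `C > 0` with `‖(b^U(s))⁻¹‖ ≤ C` for EVERY set `U` of finite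
  places and every `Re s ≥ σ₀`, `b^U(s) = ζ_F^U(2s+1)·L^U(2s+2, ε)`: the `ζ`-part is Track-A ★ `K2E1WhittakerBoundsUniformU2.norm_inv_partialZeta_le_uniform` BY NAME at
  `x₁ = 2σ₀ + 1 > 1`; the `L(·,ε)`-part is its twin with a coefficient of norm `≤ 1` (`norm_inv_partialL_le_uniform`: `L^U(w,ε)⁻¹ = ∏'_{v∉U}(1 − ε(ϖ_v)q_v^{−w})`, every partial
  product has norm `≤ exp(Σ_v q_v^{−x₁})`, ★ `hasProd_partialStandardL_singleton` inverted, norms pass to the limit); CM twin `norm_inv_b_le_uniform_cm`.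
* §2 **`norm_face_le_uniform`** — the face bound in (b)'s currency: ONE `C` with `‖(b^U(s))⁻¹ · ∏_{v∈ι} W v ∕ m v‖ ≤ C · ∏_{v∈ι} B v` for every `U`, every
  `Re s ≥ σ₀`, every finite `ι` (read `D(β)∖T`) and all `W, m > 0, B` with `‖W v‖ ≤ B v · m v` on `ι` (R1's `B v = N_v^{3+2e_v}`).
* §3 **`prod_residueCard_pow_affine_le`** — THE PRODUCT FORMULA STEP (Track-A ★ `prod_residueCard_pow_le_mul_abs_norm` BY NAME): `ξ ∈ F×` (read `det β`, up to the
  frame's unit) in the box `ord_v ξ ≥ e_v` (`e` finitely supported: the lattice `Λ(f,h_f)` bounds denominators), `T′` finite with `ord_v ξ = e_v + n_v`, `n_v ≥ 1` on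
  `T′` (read `T′ = D(β)∖T`: integral and not unimodular ⇒ `ord_v(det β) ≥ 1`); then for all `a b ∈ ℕ`
  `∏_{v∈T′} q_v^{a + b·n_v} ≤ (C_e·|N_{F∕ℚ} ξ|)^{a+b} ≤ (C_e·‖ξ_∞‖^{[F:ℚ]})^{a+b}` (`C_e = ∏_{e_v≠0} q_v^{−e_v}`; `a + b n ≤ (a+b) n` for `n ≥ 1`;
  ★ `abs_norm_le_norm_mixedEmbedding_pow`) — polynomial in the archimedean size of `det β`, as (A-13)∕(H2) `summable_lattice_prod_majorant` wants.
* §4 **`toReal_prod_inv_normAbs_toPlace_pow`** — THE DICTIONARY `N_v^K = q_v^{2n²K}` between R1's volume-growth base `N_v = ∏_{(i,j,w)} |ι_w π|_w⁻¹` (★ U3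
  `K2LiuSkewBallVolumeGrowth`) and `q_v` for a quadratic `E∕F` (★ `prod_norm_toPlace_uniformizer`: `∏_{w∣v} ‖ι_w π‖_w = q_v⁻²`; ★ `norm_eq_absNorm_zpow` ∕
  ★ `normAbs_eq_inv_zpow_of_valued_eq`: Mathlib's norm on `E_w` is the normalised absolute value).
HONEST LABEL.  Count-neutral helper; it retires nothing by itself: `HC_CM` is proved only modulo the 7 printed citations (2 remaining named inputs:
hLiu418 = `stmt-HodgeConjecture-24832`, h413 = `stmt-HodgeConjecture-24833`) until rung 0 closes.

## References
* [NeukirchANT1999] J. Neukirch, *Algebraic Number Theory* (1999): Ch. III (1.3) (product formula), Ch. VII (5.2), §8 (8.1) (Euler products of `ζ_F`, `L(s,ε)` on `Re > 1`).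
* [KudlaRallis1994] S. Kudla, S. Rallis, Ann. of Math. 140 (1994): §1–§2 (Euler product of the Fourier coefficients; unramified local coefficients).
* [Shimura1997] G. Shimura, *Euler products and Eisenstein series*, CBMS 93 (1997): §13, §18–§19 (local densities; polynomial dependence on `|det β|_v`).
* [CasselsFrohlichANT1967] J. W. S. Cassels, A. Fröhlich (eds.), *Algebraic Number Theory* (1967): Ch. II §11 (`E ⊗ F_v = Π_{w∣v} E_w`, local degrees).
-/

set_option autoImplicit false
-- the mandated namespace repeats the single-problem summit's segment (`HodgeConjecture.HodgeConjecture`)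
set_option linter.dupNamespace false

noncomputable section

open scoped NNReal ENNReal Topology Classical
open Filter Complex NumberField IsDedekindDomain Module
open Literature.NumberTheory.Automorphic Literature.NumberTheory.Automorphic.UnitaryGroup Literature.NumberTheory.LFunctions
open Literature.NumberTheory.GaloisRepresentations Literature.NumberTheory.GaloisRepresentations.IsNonarchimedeanLocalField
open Summit.HodgeConjecture.HodgeConjecture.Cruxes.H413.F0P2wPartialDedekindZetaPole
open Summit.HodgeConjecture.HodgeConjecture.Cruxes.H413.K2E1WhittakerBoundsUniformU2
open Summit.HodgeConjecture.HodgeConjecture.Cruxes.H413.K2E1WhittakerDenBoundsUniformU3 (norm_one_sub_mul_residueCard_cpow_neg_le_exp)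
open Summit.HodgeConjecture.HodgeConjecture.Cruxes.HLiu418.K2LiuSiegelIntertwiningScalarGL1
open Summit.HodgeConjecture.HodgeConjecture.Cruxes.HLiu418.K2LiuGKRankOneIdentityLFactor

namespace Summit.HodgeConjecture.HodgeConjecture.Cruxes.HLiu418.K2LiuGoodPlaceWhittakerProductBound

variable {F : Type} [Field F] [NumberField F]

/-! ## §1 `‖(b^U(s))⁻¹‖ ≤ C(σ₀)` for `Re s ≥ σ₀ > 0`, uniformly in the set `U` of omitted places -/

section InvB

/-- finite products, coefficients of norm `≤ 1` off `S`: `‖∏_{v∈T}(1 − a_v q_v^{−w})‖ ≤ exp(Σ_v q_v^{−x₁})` for `1 < x₁ ≤ Re w` — free of `T`, `S`, `w`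
(★ `summable_residueCard_rpow_neg`; the twin of Track-A ★ `norm_prod_one_sub_residueCard_cpow_neg_le`). [cite: NeukirchANT1999, Ch. VII §8 (8.1)] -/
theorem norm_prod_one_sub_mul_residueCard_cpow_neg_le {x₁ : ℝ} (hx₁ : 1 < x₁) (S : Set (HeightOneSpectrum (𝓞 F))) {a : HeightOneSpectrum (𝓞 F) → ℂ}
    (ha : ∀ v, v ∉ S → ‖a v‖ ≤ 1) {w : ℂ} (hw : x₁ ≤ w.re) (T : Finset {v : HeightOneSpectrum (𝓞 F) // v ∉ S}) :
    ‖∏ v ∈ T, (1 - a v.1 * (v.1.residueCard : ℂ) ^ (-w))‖ ≤ Real.exp (∑' v : HeightOneSpectrum (𝓞 F), (v.residueCard : ℝ) ^ (-x₁)) := by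
  have hsum := summable_residueCard_rpow_neg (K := F) hx₁
  calc ‖∏ v ∈ T, (1 - a v.1 * (v.1.residueCard : ℂ) ^ (-w))‖ = ∏ v ∈ T, ‖1 - a v.1 * (v.1.residueCard : ℂ) ^ (-w)‖ := norm_prod _ _
    _ ≤ ∏ v ∈ T, Real.exp ((v.1.residueCard : ℝ) ^ (-x₁)) :=
        Finset.prod_le_prod (fun _ _ => norm_nonneg _) fun v _ => norm_one_sub_mul_residueCard_cpow_neg_le_exp v.1 (ha v.1 v.2) hw
    _ = Real.exp (∑ v ∈ T, (v.1.residueCard : ℝ) ^ (-x₁)) := by rw [Real.exp_sum]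
    _ ≤ Real.exp (∑' v : HeightOneSpectrum (𝓞 F), (v.residueCard : ℝ) ^ (-x₁)) := by
        refine Real.exp_le_exp.2 ?_
        calc ∑ v ∈ T, (v.1.residueCard : ℝ) ^ (-x₁)
            ≤ ∑' v : {v : HeightOneSpectrum (𝓞 F) // v ∉ S}, (v.1.residueCard : ℝ) ^ (-x₁) :=
              (hsum.subtype _).sum_le_tsum T fun v _ => by positivity
          _ ≤ ∑' v : HeightOneSpectrum (𝓞 F), (v.residueCard : ℝ) ^ (-x₁) :=
              hsum.tsum_subtype_le (fun v : HeightOneSpectrum (𝓞 F) => (v.residueCard : ℝ) ^ (-x₁)) _ fun v => by positivity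

/-- **UNIFORM INVERSE PARTIAL `L`-FUNCTION BOUND** (coefficients of norm `≤ 1`, e.g. `a_v = ε(ϖ_v)` for a unitary Hecke character): for `x₁ > 1` there is ONE
`C > 0` with `‖L^S(w, a)⁻¹‖ ≤ C` for EVERY set `S` of finite places and every `Re w ≥ x₁`, `L^S(w,a) = partialStandardL S (v ↦ {a_v}) w = ∏'_{v∉S}(1 − a_v q_v^{−w})⁻¹`
(★ `hasProd_partialStandardL_singleton`, inverted through `Tendsto.inv₀`; every partial product of the inverse has norm `≤ exp(Σ_v q_v^{−x₁})`; `le_of_tendsto'`).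
[cite: NeukirchANT1999, Ch. VII §8 (8.1)] -/
theorem norm_inv_partialL_le_uniform {x₁ : ℝ} (hx₁ : 1 < x₁) {a : HeightOneSpectrum (𝓞 F) → ℂ} (ha : ∀ v, ‖a v‖ ≤ 1) :
    ∃ C : ℝ, 0 < C ∧ ∀ (S : Set (HeightOneSpectrum (𝓞 F))) (w : ℂ), x₁ ≤ w.re →
      ‖(partialStandardL S (fun v => ({a v} : Multiset ℂ)) w)⁻¹‖ ≤ C := by
  refine ⟨Real.exp (∑' v : HeightOneSpectrum (𝓞 F), (v.residueCard : ℝ) ^ (-x₁)), Real.exp_pos _, fun S w hw => ?_⟩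
  have hw1 : 1 < w.re := lt_of_lt_of_le hx₁ hw
  obtain ⟨hprod, hne⟩ := hasProd_partialStandardL_singleton (K := F) (S := S) a (fun v _ => ha v) hw1
  have hinv : Tendsto (fun T : Finset {v : HeightOneSpectrum (𝓞 F) // v ∉ S} => ∏ v ∈ T, (1 - a v.1 * (v.1.residueCard : ℂ) ^ (-w))) atTop
      (𝓝 (partialStandardL S (fun v => ({a v} : Multiset ℂ)) w)⁻¹) := by
    have h : Tendsto (fun T : Finset {v : HeightOneSpectrum (𝓞 F) // v ∉ S} => ∏ v ∈ T, (1 - a v.1 * (v.1.residueCard : ℂ) ^ (-w))⁻¹) atTop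
        (𝓝 (partialStandardL S (fun v => ({a v} : Multiset ℂ)) w)) := hprod
    simpa only [Finset.prod_inv_distrib, inv_inv] using h.inv₀ hne
  exact le_of_tendsto' hinv.norm fun T => norm_prod_one_sub_mul_residueCard_cpow_neg_le hx₁ S (fun v _ => ha v) hw T

/-- **`‖(b^U(s))⁻¹‖ ≤ C(σ₀)` UNIFORMLY IN `U` AND IN `Re s ≥ σ₀ > 0`**, `b^U(s) = ζ_F^U(2s+1)·L^U(2s+2, ε)` for a unitary Hecke character `ε` (the O41.6 ∕ (b)
normalising factor; `Re(2s+1), Re(2s+2) ≥ 2σ₀ + 1 > 1`): the `ζ`-part is Track-A ★ `norm_inv_partialZeta_le_uniform`, the `L`-part `norm_inv_partialL_le_uniform`.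
So the moving set `U = D(β) ∪ T` of row G2's face is harmless for the Φ9 majorant. [cite: NeukirchANT1999, Ch. VII (5.2)] [cite: KudlaRallis1994, §1] -/
theorem norm_inv_b_le_uniform {ε : HeckeCharacter F} (hε : ε.IsUnitary) {σ₀ : ℝ} (hσ₀ : 0 < σ₀) :
    ∃ C : ℝ, 0 < C ∧ ∀ (U : Set (HeightOneSpectrum (𝓞 F))) (s : ℂ), σ₀ ≤ s.re →
      ‖(partialStandardL U (fun _ => ({1} : Multiset ℂ)) (2 * s + 1) * partialStandardL U (fun v => {ε.valueAtUniformizer v}) (2 * s + 2))⁻¹‖ ≤ C := by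
  obtain ⟨C₁, hC₁, h₁⟩ := norm_inv_partialZeta_le_uniform (K := F) (x₁ := 2 * σ₀ + 1) (by linarith)
  obtain ⟨C₂, hC₂, h₂⟩ := norm_inv_partialL_le_uniform (F := F) (x₁ := 2 * σ₀ + 1) (by linarith)
    (a := fun v => ε.valueAtUniformizer v) fun v => (HeckeCharacter.norm_valueAtUniformizer_of_isUnitary hε v).le
  refine ⟨C₁ * C₂, mul_pos hC₁ hC₂, fun U s hs => ?_⟩
  have hre1 : 2 * σ₀ + 1 ≤ (2 * s + 1).re := by
    simp only [add_re, mul_re, re_ofNat, im_ofNat, one_re, zero_mul, sub_zero]; linarith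
  have hre2 : 2 * σ₀ + 1 ≤ (2 * s + 2).re := by
    simp only [add_re, mul_re, re_ofNat, im_ofNat, zero_mul, sub_zero]; linarith
  rw [mul_inv, norm_mul]
  exact mul_le_mul (h₁ U _ hre1) (h₂ U _ hre2) (norm_nonneg _) hC₁.le

end InvB

/-! ## §2 The face bound in (b)'s currency -/

section Face

/-- **ROW G2's FACE IS BOUNDED BY `C · ∏_{v∈ι} B_v`** on `{σ₀ ≤ Re s}`, uniformly in the moving set: for `ε` unitary and `σ₀ > 0` there is ONE `C > 0` such that for
every set `U` (read `D(β) ∪ T`), every `Re s ≥ σ₀`, every finite `ι` (read `D(β) ∖ T`) and all values `W v`, volumes `m v > 0` and bounds `B v` with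
`‖W v‖ ≤ B v · m v` on `ι` (R1 `goodPlace_whittaker_nonUnimodular` (b): `B v = N_v^{3+2e_v}`):
`‖(b^U(s))⁻¹ · ∏_{v∈ι} W v ∕ m v‖ ≤ C · ∏_{v∈ι} B v`. [cite: KudlaRallis1994, §1–§2] [cite: Shimura1997, §19] -/
theorem norm_face_le_uniform {ε : HeckeCharacter F} (hε : ε.IsUnitary) {σ₀ : ℝ} (hσ₀ : 0 < σ₀) :
    ∃ C : ℝ, 0 < C ∧ ∀ (U : Set (HeightOneSpectrum (𝓞 F))) (s : ℂ), σ₀ ≤ s.re →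
      ∀ (ι : Finset (HeightOneSpectrum (𝓞 F))) (W : HeightOneSpectrum (𝓞 F) → ℂ) (m B : HeightOneSpectrum (𝓞 F) → ℝ),
        (∀ v ∈ ι, 0 < m v) → (∀ v ∈ ι, ‖W v‖ ≤ B v * m v) →
        ‖(partialStandardL U (fun _ => ({1} : Multiset ℂ)) (2 * s + 1) * partialStandardL U (fun v => {ε.valueAtUniformizer v}) (2 * s + 2))⁻¹ *
            ∏ v ∈ ι, W v / (m v : ℂ)‖ ≤ C * ∏ v ∈ ι, B v := by
  obtain ⟨C, hC, h⟩ := norm_inv_b_le_uniform hε hσ₀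
  refine ⟨C, hC, fun U s hs ι W m B hm hW => ?_⟩
  rw [norm_mul, norm_prod]
  have hfac : ∀ v ∈ ι, ‖W v / (m v : ℂ)‖ ≤ B v := fun v hv => by
    rw [norm_div, Complex.norm_real, Real.norm_of_nonneg (hm v hv).le, div_le_iff₀ (hm v hv)]
    exact hW v hv
  exact mul_le_mul (h U s hs) (Finset.prod_le_prod (fun _ _ => norm_nonneg _) hfac) (Finset.prod_nonneg fun _ _ => norm_nonneg _) hC.le

end Face

/-! ## §3 The product formula step: `∏_{v∈T′} q_v^{a + b·n_v} ≤ (C_e·|N ξ|)^{a+b}` -/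

section ProductFormula

/-- **`∏_{v∈T′} q_v^{a + b·n_v} ≤ (C_e · |N_{F∕ℚ} ξ|)^{a+b}`** for `ξ ∈ F×` in the box `ord_v ξ ≥ e_v` (`e` finitely supported, `C_e = ∏_{e_v ≠ 0} q_v^{−e_v}`),
`T′` finite with `ord_v ξ = e_v + n_v` and `1 ≤ n_v` on `T′` (`a + b·n ≤ (a+b)·n` for `n ≥ 1`, `q_v ≥ 1`; then Track-A ★ `prod_residueCard_pow_le_mul_abs_norm`:
`∏_{v∈T′} q_v^{n_v} ≤ C_e·|N ξ|`).  Read `ξ = det β`, `T′ = D(β) ∖ T`, `(a,b) = (3·2n², 2·2n²)`: the product of R1's bounds `N_v^{3+2·ord_v(det β)}` over the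
non-unimodular good places is polynomial in `|N(det β)|`. [cite: NeukirchANT1999, Ch. III (1.3)] [cite: Shimura1997, §13, §19] -/
theorem prod_residueCard_pow_affine_le {e : HeightOneSpectrum (𝓞 F) → ℤ} (he : ∀ᶠ v in cofinite, e v = 0)
    {ξ : F} (hξ : ξ ≠ 0) (hbox : ∀ v : HeightOneSpectrum (𝓞 F), v.valuation F ξ ≤ WithZero.exp (-e v))
    (T' : Finset (HeightOneSpectrum (𝓞 F))) (nn : HeightOneSpectrum (𝓞 F) → ℕ)
    (hT : ∀ v ∈ T', v.valuation F ξ = WithZero.exp (-(e v + nn v))) (h1 : ∀ v ∈ T', 1 ≤ nn v) (a b : ℕ) :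
    ∏ v ∈ T', (v.residueCard : ℝ) ^ (a + b * nn v) ≤
      ((∏ v ∈ he.toFinset, (v.residueCard : ℝ) ^ (-e v)) * |(Algebra.norm ℚ ξ : ℝ)|) ^ (a + b) := by
  have hq : ∀ v : HeightOneSpectrum (𝓞 F), (1 : ℝ) ≤ v.residueCard := fun v => by exact_mod_cast v.one_lt_residueCard.le
  have hstep : ∏ v ∈ T', (v.residueCard : ℝ) ^ (a + b * nn v) ≤ ∏ v ∈ T', ((v.residueCard : ℝ) ^ nn v) ^ (a + b) :=
    Finset.prod_le_prod (fun v _ => by positivity) fun v hv => by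
      rw [← pow_mul]
      exact pow_le_pow_right₀ (hq v) (by nlinarith [h1 v hv])
  refine hstep.trans ?_
  rw [Finset.prod_pow]
  exact pow_le_pow_left₀ (Finset.prod_nonneg fun v _ => by positivity) (prod_residueCard_pow_le_mul_abs_norm he hξ hbox T' nn hT) _

/-- **… `≤ (C_e · ‖ξ_∞‖^{[F:ℚ]})^{a+b}`**, `‖ξ_∞‖ = ‖mixedEmbedding F ξ‖` (Track-A ★ `abs_norm_le_norm_mixedEmbedding_pow`: `|N ξ| ≤ ‖ξ_∞‖^{[F:ℚ]}`) — polynomial in the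
archimedean size of `ξ = det β`, the shape (A-13)∕(H2) `summable_lattice_prod_majorant` consumes. [cite: NeukirchANT1999, Ch. III (1.3)] -/
theorem prod_residueCard_pow_affine_le_mixedEmbedding {e : HeightOneSpectrum (𝓞 F) → ℤ} (he : ∀ᶠ v in cofinite, e v = 0)
    {ξ : F} (hξ : ξ ≠ 0) (hbox : ∀ v : HeightOneSpectrum (𝓞 F), v.valuation F ξ ≤ WithZero.exp (-e v))
    (T' : Finset (HeightOneSpectrum (𝓞 F))) (nn : HeightOneSpectrum (𝓞 F) → ℕ)
    (hT : ∀ v ∈ T', v.valuation F ξ = WithZero.exp (-(e v + nn v))) (h1 : ∀ v ∈ T', 1 ≤ nn v) (a b : ℕ) :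
    ∏ v ∈ T', (v.residueCard : ℝ) ^ (a + b * nn v) ≤
      ((∏ v ∈ he.toFinset, (v.residueCard : ℝ) ^ (-e v)) * ‖mixedEmbedding F ξ‖ ^ finrank ℚ F) ^ (a + b) := by
  refine (prod_residueCard_pow_affine_le he hξ hbox T' nn hT h1 a b).trans (pow_le_pow_left₀ (by positivity) ?_ _)
  exact mul_le_mul_of_nonneg_left (abs_norm_le_norm_mixedEmbedding_pow ξ) (Finset.prod_nonneg fun v _ => by positivity)

end ProductFormula

/-! ## §4 The dictionary `N_v^K = q_v^{2n²K}` (quadratic `E ∕ F`) -/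

section Dictionary

variable (F) (E : Type) [Field E] [NumberField E] [Algebra F E] [Algebra.IsQuadraticExtension F E]
  (v : HeightOneSpectrum (𝓞 F)) {π : v.adicCompletion F} (hπ : Valued.v π = WithZero.exp (-1 : ℤ))

omit [Algebra.IsQuadraticExtension F E] in
/-- Mathlib's norm on `E_w` IS the normalised absolute value `normAbs E_w` (both are `q_w^{k}` at valuation `exp k`: ★ `norm_eq_absNorm_zpow`,
★ `normAbs_eq_inv_zpow_of_valued_eq`, ★ `residueFieldCard_adicCompletion_eq_absNorm`), read at the elements `ι_w π`. [cite: CasselsFrohlichANT1967, Ch. II §11] -/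
theorem coe_normAbs_toPlace_eq_norm (w : PlacesOver E v) :
    ((normAbs (w.1.adicCompletion E) (toPlace v w π) : ℝ≥0) : ℝ) = ‖toPlace v w π‖ := by
  set x : w.1.adicCompletion E := toPlace v w π with hx
  by_cases h0 : x = 0
  · rw [h0, map_zero, norm_zero, NNReal.coe_zero]
  have hv : Valued.v x ≠ 0 := (Valuation.ne_zero_iff _).2 h0
  set k : ℤ := Multiplicative.toAdd (WithZero.unzero hv) with hk
  have hxk : Valued.v x = ((Multiplicative.ofAdd k : Multiplicative ℤ) : WithZero (Multiplicative ℤ)) := by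
    rw [hk, ofAdd_toAdd, WithZero.coe_unzero]
  have hxk' : Valued.v x = WithZero.exp k := by rw [WithZero.exp]; exact hxk
  rw [Literature.NumberTheory.GaloisRepresentations.Ultrametric.AdicCompletion.norm_eq_absNorm_zpow E w.1 k hxk,
    normAbs_eq_inv_zpow_of_valued_eq w.1 hxk', inv_zpow', neg_neg, residueFieldCard_adicCompletion_eq_absNorm E w.1]
  push_cast
  rfl

include hπ in
/-- **THE DICTIONARY `N_v^K = q_v^{2n²K}`** between R1's volume-growth base `N_v = ∏_{(i,j,w)} |ι_w π|_w⁻¹` (★ U3 `measure_ball_sub_le_pow_mul`, ★∕📤 R1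
`goodPlace_whittaker_nonUnimodular` (b), in `ℝ≥0∞` read through `toReal`) and the residue cardinality `q_v`, for a quadratic extension `E ∕ F` and a uniformizer `π`
of `F_v`: `∏_{w∣v} ‖ι_w π‖_w = q_v⁻²` (★ `prod_norm_toPlace_uniformizer`), hence `N_v = (q_v²)^{n·n}`.  With §3 (`ξ = det β`) this makes R1's bound polynomial in
`|N(det β)|`. [cite: CasselsFrohlichANT1967, Ch. II §11] [cite: Shimura1997, §13] -/
theorem toReal_prod_inv_normAbs_toPlace_pow (n K : ℕ) :
    ((∏ p : Fin n × Fin n × PlacesOver E v, ((normAbs (p.2.2.1.adicCompletion E) (toPlace v p.2.2 π) : ℝ≥0∞))⁻¹) ^ K).toReal =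
      (v.residueCard : ℝ) ^ (2 * (n * n) * K) := by
  -- read in `ℝ`
  rw [ENNReal.toReal_pow, ENNReal.toReal_prod]
  simp_rw [ENNReal.toReal_inv, ENNReal.coe_toReal]
  -- the place product: `∏_w (normAbs E_w (ι_w π))⁻¹ = (∏_w ‖ι_w π‖)⁻¹ = q_v²`
  have hw : ∏ w : PlacesOver E v, ((normAbs (w.1.adicCompletion E) (toPlace v w π) : ℝ≥0) : ℝ)⁻¹ = (v.residueCard : ℝ) ^ 2 := by
    rw [Finset.prod_inv_distrib]
    simp_rw [coe_normAbs_toPlace_eq_norm F E v]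
    rw [prod_norm_toPlace_uniformizer F E v hπ, inv_pow, inv_inv, residueFieldCard_adicCompletion_eq F v]
  -- collapse the `(i, j)`-repetitions
  have hrow : ∀ i : Fin n, ∏ q : Fin n × PlacesOver E v, ((normAbs ((i, q).2.2.1.adicCompletion E) (toPlace v (i, q).2.2 π) : ℝ≥0) : ℝ)⁻¹ =
      ((v.residueCard : ℝ) ^ 2) ^ n := fun i => by
    rw [Fintype.prod_prod_type]
    show ∏ _j : Fin n, ∏ w : PlacesOver E v, ((normAbs (w.1.adicCompletion E) (toPlace v w π) : ℝ≥0) : ℝ)⁻¹ = _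
    rw [Finset.prod_const, Finset.card_univ, Fintype.card_fin, hw]
  have hprod : ∏ p : Fin n × Fin n × PlacesOver E v, ((normAbs (p.2.2.1.adicCompletion E) (toPlace v p.2.2 π) : ℝ≥0) : ℝ)⁻¹ =
      ((v.residueCard : ℝ) ^ 2) ^ (n * n) := by
    rw [Fintype.prod_prod_type, Finset.prod_congr rfl fun i _ => hrow i, Finset.prod_const, Finset.card_univ, Fintype.card_fin, ← pow_mul,
      mul_comm]
  rw [hprod, ← pow_mul, ← pow_mul, ← mul_assoc]

end Dictionary

/-! ## §5 The CM twins at the K2_Liu frame: `F = L⁺`, `ε = ε_{L∕L⁺}` -/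

section CM

variable (L : Type) [Field L] [NumberField L] [IsCMField L]

/-- **`‖(b^U(s))⁻¹‖ ≤ C(σ₀)` AT THE K2_Liu FRAME** (`F = L⁺`, `ε = ε_{L∕L⁺} =` ★ `quadraticHeckeCharCM L`, unitary as a character of finite order ★
`isFiniteOrder_quadraticHeckeCharCM` — the (b) §5 pattern), uniformly in `U` and in `Re s ≥ σ₀ > 0`. [cite: NeukirchANT1999, Ch. VII (5.2)] [cite: KudlaRallis1994, §1] -/
theorem norm_inv_b_le_uniform_cm {σ₀ : ℝ} (hσ₀ : 0 < σ₀) :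
    ∃ C : ℝ, 0 < C ∧ ∀ (U : Set (HeightOneSpectrum (𝓞 ↥(maximalRealSubfield L)))) (s : ℂ), σ₀ ≤ s.re →
      ‖(partialStandardL U (fun _ => ({1} : Multiset ℂ)) (2 * s + 1) *
          partialStandardL U (fun v => {(quadraticHeckeCharCM L).valueAtUniformizer v}) (2 * s + 2))⁻¹‖ ≤ C :=
  norm_inv_b_le_uniform (Literature.RepresentationTheory.HarrisKudlaSweet1996.isFiniteOrder_quadraticHeckeCharCM (L := L)).isUnitary hσ₀

/-- **ROW G2's FACE BOUND AT THE K2_Liu FRAME**: ONE `C(σ₀)` with `‖(b^U(s))⁻¹ · ∏_{v∈ι} W v ∕ m v‖ ≤ C · ∏_{v∈ι} B v` for every `U`, `Re s ≥ σ₀`, finite `ι`,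
and `‖W v‖ ≤ B v · m v`, `m v > 0` on `ι`. [cite: KudlaRallis1994, §1–§2] [cite: Shimura1997, §19] -/
theorem norm_face_le_uniform_cm {σ₀ : ℝ} (hσ₀ : 0 < σ₀) :
    ∃ C : ℝ, 0 < C ∧ ∀ (U : Set (HeightOneSpectrum (𝓞 ↥(maximalRealSubfield L)))) (s : ℂ), σ₀ ≤ s.re →
      ∀ (ι : Finset (HeightOneSpectrum (𝓞 ↥(maximalRealSubfield L)))) (W : HeightOneSpectrum (𝓞 ↥(maximalRealSubfield L)) → ℂ)
        (m B : HeightOneSpectrum (𝓞 ↥(maximalRealSubfield L)) → ℝ),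
        (∀ v ∈ ι, 0 < m v) → (∀ v ∈ ι, ‖W v‖ ≤ B v * m v) →
        ‖(partialStandardL U (fun _ => ({1} : Multiset ℂ)) (2 * s + 1) *
              partialStandardL U (fun v => {(quadraticHeckeCharCM L).valueAtUniformizer v}) (2 * s + 2))⁻¹ *
            ∏ v ∈ ι, W v / (m v : ℂ)‖ ≤ C * ∏ v ∈ ι, B v :=
  norm_face_le_uniform (Literature.RepresentationTheory.HarrisKudlaSweet1996.isFiniteOrder_quadraticHeckeCharCM (L := L)).isUnitary hσ₀

end CM

end Summit.HodgeConjecture.HodgeConjecture.Cruxes.HLiu418.K2LiuGoodPlaceWhittakerProductBound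

end
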